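import Literature.AlgebraicGeometry.HodgeTheory.CyclicReflectionEigencomponents
import Literature.AlgebraicGeometry.HodgeTheory.BilinFormComplexSpanNondegenerate
import Literature.AlgebraicGeometry.HodgeTheory.CyclicVectorIndependent
import HarnessLib

/-!
# The eigencomponents of a vanishing vector are non-zero and `h`-anisotropic (Carlson–Toledo 1999 §6–§7:
# "we can normalize the eigenvector `η_i` to an eigenvector `δ_i` satisfying `h(δ_i, δ_i) = ε_i = ±1`")
# — packaging, part 4

Family `hodge`, layer `Literature/AlgebraicGeometry/HodgeTheory`. THEOREMS only. Sequel of
`CyclicReflectionEigencomponents` (δ_j := π_j(1 ⊗ δ)), `CyclicVectorIndependent` (`δ, …, τ^{p−2}δ` independent)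
and `BilinFormComplexSpanNondegenerate` (Gram determinant over ℂ), for crux K1 of
`Summits/HodgeConjecture/HodgeConjecture/Theses/CyclicUnitaryPowers.lean` (R1 packaging, lanes A/D): from the
clauses of statement D for a vanishing vector `δ` (`δ ≠ 0`, `Σ_{i<p} τ^i δ = 0`, `B` non-degenerate on the cyclic
span) we get `δ_0 = 0`, `δ_j ≠ 0` for `0 < j < p`, and `h(δ_j, δ_j) ≠ 0` — so `δ_j` can be normalised to
`h(δ̂_j, δ̂_j) = ±1`, the hypothesis of Carlson–Toledo's complex reflections / density theorem on `H(ζ^j)`.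
Written by the prover seat `hodge-nonav-prover-Ax`.

## References
* [CarlsonToledo1999] J. A. Carlson, D. Toledo, Duke Math. J. 97 (1999), §6 (pp. 13–14), §7 (p. 16).
-/

noncomputable section

open Module Literature.AlgebraicGeometry.Motives
open scoped TensorProduct ComplexConjugate

namespace Literature.AlgebraicGeometry.HodgeTheory

universe v

variable {V : Type v} [AddCommGroup V] [Module ℚ V]

/-! ### §1 `δ_0 = 0` and the complexified cyclic span -/

/-- **`δ_0 = 0`**: the eigencomponent for the eigenvalue `1 = ζ^0` of a vector killed by `Σ_{i<p} τ^i`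
vanishes (the vanishing space has no invariants). [cite: CarlsonToledo1999, §6 (p. 13)] -/
theorem eigencomponent_zero_eq_zero (τ : V →ₗ[ℚ] V) {p : ℕ} (ζ : ℂ) {δ : V}
    (hsum : ∑ i ∈ Finset.range p, (τ ^ i) δ = 0) : eigencomponent τ p ζ 0 δ = 0 := by
  rw [eigencomponent_def, cyclicEigenProjector_apply]
  simp only [mul_zero, pow_zero, one_smul]
  have h : ∑ i ∈ Finset.range p, ((τ.baseChange ℂ) ^ i) ((1 : ℂ) ⊗ₜ[ℚ] δ) =
      (1 : ℂ) ⊗ₜ[ℚ] (∑ i ∈ Finset.range p, (τ ^ i) δ) := by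
    rw [TensorProduct.tmul_sum]
    refine Finset.sum_congr rfl fun i _ => ?_
    rw [← LinearMap.baseChange_pow, LinearMap.baseChange_tmul]
  rw [h, hsum, TensorProduct.tmul_zero, smul_zero]

/-- Each `1 ⊗ τ^i δ` lies in the complex span of the first `p − 1` of them (`τ^p = 1`, `Σ τ^i δ = 0`).
[cite: CarlsonToledo1999, §6 (p. 13)] -/
theorem one_tmul_pow_apply_mem_span_fin {τ : V →ₗ[ℚ] V} {p : ℕ} (hp : 2 ≤ p) (hτ : τ ^ p = 1) {δ : V}
    (hsum : ∑ i ∈ Finset.range p, (τ ^ i) δ = 0) (i : ℕ) :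
    (1 : ℂ) ⊗ₜ[ℚ] ((τ ^ i) δ) ∈ Submodule.span ℂ (Set.range fun k : Fin (p - 1) => (1 : ℂ) ⊗ₜ[ℚ] ((τ ^ (k : ℕ)) δ)) := by
  obtain ⟨q, hq⟩ := (Submodule.mem_span_range_iff_exists_fun ℚ).1 (pow_apply_mem_span_pow_apply_fin hp hτ hsum i)
  rw [← hq, TensorProduct.tmul_sum]
  refine Submodule.sum_mem _ fun k _ => ?_
  rw [TensorProduct.tmul_smul, ← algebraMap_smul ℂ (q k)]
  exact Submodule.smul_mem _ _ (Submodule.subset_span ⟨k, rfl⟩)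

/-- **`(1 ⊗ τ^k δ)_{k < p−1}` is `ℂ`-linearly independent** (Gram determinant of the non-degenerate symmetric
`B` on the cyclic span, read over `ℂ`). [cite: CarlsonToledo1999, §6 (p. 13)] -/
theorem linearIndependent_one_tmul_pow_apply {τ : V →ₗ[ℚ] V} {p : ℕ} (hp : p.Prime) (hτ : τ ^ p = 1)
    {B : LinearMap.BilinForm ℚ V} (hB : B.IsSymm) {δ : V} (hδ : δ ≠ 0)
    (hsum : ∑ i ∈ Finset.range p, (τ ^ i) δ = 0)
    (hnd : ∀ x ∈ Submodule.span ℚ (Set.range fun i : ℕ => (τ ^ i) δ),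
      (∀ y ∈ Submodule.span ℚ (Set.range fun i : ℕ => (τ ^ i) δ), B x y = 0) → x = 0) :
    LinearIndependent ℂ (fun k : Fin (p - 1) => (1 : ℂ) ⊗ₜ[ℚ] ((τ ^ (k : ℕ)) δ)) := by
  set v : Fin (p - 1) → V := fun k => (τ ^ (k : ℕ)) δ with hv
  have hli : LinearIndependent ℚ v := linearIndependent_pow_apply_of_sum_eq_zero hp hδ hsum
  have hspan := span_pow_apply_eq hp.two_le hτ hsum
  have hnd' : ∀ x ∈ Submodule.span ℚ (Set.range v), (∀ y ∈ Submodule.span ℚ (Set.range v), B x y = 0) → x = 0 := by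
    rw [hv, ← hspan]; exact hnd
  have hdet := det_gram_ne_zero hB v hli hnd'
  rw [Fintype.linearIndependent_iff]
  intro c hc
  set G : Matrix (Fin (p - 1)) (Fin (p - 1)) ℚ := Matrix.of fun i k => B (v i) (v k) with hG
  have hdet' : (G.map ((↑) : ℚ → ℂ)).det ≠ 0 := by
    rw [show (G.map ((↑) : ℚ → ℂ)) = (Rat.castHom ℂ).mapMatrix G from rfl, ← RingHom.map_det]
    exact (map_ne_zero_iff _ (Rat.castHom ℂ).injective).2 hdet
  have hvec : Matrix.vecMul c (G.map ((↑) : ℚ → ℂ)) = 0 := by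
    funext k
    have h := congrArg (fun x => B.baseChange ℂ x ((1 : ℂ) ⊗ₜ v k)) hc
    simp only [map_sum, LinearMap.sum_apply, map_smul, LinearMap.smul_apply, LinearMap.BilinForm.baseChange_tmul,
      mul_one, smul_eq_mul, map_zero, LinearMap.zero_apply] at h
    rw [Matrix.vecMul, dotProduct, Pi.zero_apply, ← h]
    refine Finset.sum_congr rfl fun i _ => ?_
    rw [Matrix.map_apply, hG, Matrix.of_apply, Rat.smul_one_eq_cast]
  exact congrFun (Matrix.eq_zero_of_vecMul_eq_zero hdet' hvec)

/-! ### §2 `δ_j ≠ 0` for `0 < j < p` (dimension count) -/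

/-- The enumeration of `{1, …, p−1} ∖ {j}` by `Fin (p−2)`. [folklore] -/
private def skipEnum (j : ℕ) (m : ℕ) : ℕ := if m + 1 < j then m + 1 else m + 2

/-- Every `m ∈ {1, …, p−1} ∖ {j}` is in the image of the enumeration. [folklore] -/
private theorem exists_skipEnum_eq {p j m : ℕ} (hj1 : 1 ≤ j) (hjp : j < p) (hm : m < p) (hm0 : m ≠ 0) (hmj : m ≠ j) :
    ∃ m' : ℕ, m' < p - 2 ∧ skipEnum j m' = m := by
  by_cases h : m < j
  · exact ⟨m - 1, by omega, by unfold skipEnum; rw [if_pos (by omega)]; omega⟩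
  · exact ⟨m - 2, by omega, by unfold skipEnum; rw [if_neg (by omega)]; omega⟩

/-- **`δ_j ≠ 0` for `0 < j < p`** (`p` prime, `ζ` primitive, `δ ≠ 0`, `Σ τ^i δ = 0`, `B` symmetric and
non-degenerate on the cyclic span): otherwise the `p − 1` independent vectors `1 ⊗ τ^k δ = Σ_m ζ^{km} δ_m` would
lie in the span of the `p − 2` eigencomponents `δ_m`, `m ∉ {0, j}`. [cite: CarlsonToledo1999, §7 (p. 16)] -/
theorem eigencomponent_ne_zero {τ : V →ₗ[ℚ] V} {p : ℕ} (hp : p.Prime) (hτ : τ ^ p = 1) {ζ : ℂ}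
    (hζ : IsPrimitiveRoot ζ p) {B : LinearMap.BilinForm ℚ V} (hB : B.IsSymm) {δ : V} (hδ : δ ≠ 0)
    (hsum : ∑ i ∈ Finset.range p, (τ ^ i) δ = 0)
    (hnd : ∀ x ∈ Submodule.span ℚ (Set.range fun i : ℕ => (τ ^ i) δ),
      (∀ y ∈ Submodule.span ℚ (Set.range fun i : ℕ => (τ ^ i) δ), B x y = 0) → x = 0)
    {j : ℕ} (hj1 : 1 ≤ j) (hjp : j < p) : eigencomponent τ p ζ j δ ≠ 0 := by
  intro hj0
  have hp0 : 0 < p := hp.pos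
  -- `S = span {1 ⊗ τ^k δ : k < p-1}` has dimension `p − 1`
  have hS : finrank ℂ (Submodule.span ℂ (Set.range fun k : Fin (p - 1) => (1 : ℂ) ⊗ₜ[ℚ] ((τ ^ (k : ℕ)) δ))) = p - 1 := by
    rw [finrank_span_eq_card (linearIndependent_one_tmul_pow_apply hp hτ hB hδ hsum hnd), Fintype.card_fin]
  -- `T = span {δ_m : m ∉ {0,j}}`, indexed by `Fin (p-2)`, has dimension `≤ p − 2`
  set g : Fin (p - 2) → ℂ ⊗[ℚ] V := fun m => eigencomponent τ p ζ (skipEnum j m) δ with hg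
  have hT : finrank ℂ (Submodule.span ℂ (Set.range g)) ≤ p - 2 :=
    (finrank_range_le_card g).trans (Fintype.card_fin _).le
  -- `S ≤ T`
  have hST : Submodule.span ℂ (Set.range fun k : Fin (p - 1) => (1 : ℂ) ⊗ₜ[ℚ] ((τ ^ (k : ℕ)) δ)) ≤
      Submodule.span ℂ (Set.range g) := by
    rw [Submodule.span_le]
    rintro _ ⟨k, rfl⟩
    rw [SetLike.mem_coe]
    dsimp only
    rw [tmul_pow_apply_eq_sum_eigencomponent hτ hζ hp0 (k : ℕ) δ]
    refine Submodule.sum_mem _ fun m hm => ?_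
    have hmp : m < p := Finset.mem_range.1 hm
    by_cases hm0 : m = 0
    · rw [hm0, eigencomponent_zero_eq_zero τ ζ hsum, smul_zero]; exact Submodule.zero_mem _
    by_cases hmj : m = j
    · rw [hmj, hj0, smul_zero]; exact Submodule.zero_mem _
    obtain ⟨m', hm', hmm'⟩ := exists_skipEnum_eq hj1 hjp hmp hm0 hmj
    refine Submodule.smul_mem _ _ (Submodule.subset_span ⟨⟨m', hm'⟩, ?_⟩)
    rw [hg]
    simp only [hmm']
  haveI : Module.Finite ℂ (Submodule.span ℂ (Set.range g)) := Module.Finite.span_of_finite ℂ (Set.finite_range g)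
  have hle := (Submodule.finrank_mono hST).trans hT
  rw [hS] at hle
  have h2 := hp.two_le
  omega

/-! ### §3 Anisotropy: `h(δ_j, δ_j) ≠ 0` -/

/-- `h(δ_j, δ_m) = 0` for `0 ≤ j, m < p`, `m ≠ j` (`ζ` primitive): eigenspace `h`-orthogonality
(`conj(ζ^j)·ζ^m = ζ^{m−j} ≠ 1`). [cite: CarlsonToledo1999, §5 (p. 11)] -/
theorem hermitianOfBilin_eigencomponent_eq_zero_of_ne {τ : V →ₗ[ℚ] V} {p : ℕ} (hτ : τ ^ p = 1) {ζ : ℂ}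
    (hζ : IsPrimitiveRoot ζ p) (hp : 0 < p) {B : LinearMap.BilinForm ℚ V} (hτB : ∀ v w, B (τ v) (τ w) = B v w)
    (δ : V) {j m : ℕ} (hj : j < p) (hm : m < p) (hjm : m ≠ j) :
    hermitianOfBilin B (eigencomponent τ p ζ j δ) (eigencomponent τ p ζ m δ) = 0 := by
  have hζ0 : ζ ≠ 0 := hζ.ne_zero hp.ne'
  have hζ1 : ‖ζ‖ = 1 := hζ.norm'_eq_one hp.ne'
  refine hermitianOfBilin_eq_zero_of_mem_eigenspace hτB ?_
    (eigencomponent_mem_eigenspace hτ hζ.pow_eq_one hζ0 j δ) (eigencomponent_mem_eigenspace hτ hζ.pow_eq_one hζ0 m δ)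
  -- `conj(ζ^j) ζ^m = 1` would force `ζ^m = ζ^j`
  intro h1
  rw [map_pow, ← Complex.inv_eq_conj hζ1, inv_pow] at h1
  have hjm' : ζ ^ m = ζ ^ j := by
    have := congrArg (fun z => ζ ^ j * z) h1
    simp only [← mul_assoc, mul_inv_cancel₀ (pow_ne_zero j hζ0), one_mul, mul_one] at this
    exact this
  exact hjm (hζ.pow_inj hm hj hjm')

/-- **`h(δ_j, δ_j) ≠ 0` for `0 < j < p`**: otherwise `conj δ_j` would be `B_ℂ`-orthogonal to the whole complexified
cyclic span (to every `1 ⊗ τ^k δ = Σ_m ζ^{km} δ_m`, by eigenspace orthogonality), hence zero by the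
non-degeneracy of `B` on the cyclic span (Gram determinant), contradicting `δ_j ≠ 0`. So `δ_j` can be normalised
to `h(δ̂_j, δ̂_j) = ±1`. [cite: CarlsonToledo1999, §6 (p. 14) and §7 (p. 16)] -/
theorem hermitianOfBilin_eigencomponent_self_ne_zero {τ : V →ₗ[ℚ] V} {p : ℕ} (hp : p.Prime) (hτ : τ ^ p = 1)
    {ζ : ℂ} (hζ : IsPrimitiveRoot ζ p) {B : LinearMap.BilinForm ℚ V} (hB : B.IsSymm)
    (hτB : ∀ v w, B (τ v) (τ w) = B v w) {δ : V} (hδ : δ ≠ 0) (hsum : ∑ i ∈ Finset.range p, (τ ^ i) δ = 0)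
    (hnd : ∀ x ∈ Submodule.span ℚ (Set.range fun i : ℕ => (τ ^ i) δ),
      (∀ y ∈ Submodule.span ℚ (Set.range fun i : ℕ => (τ ^ i) δ), B x y = 0) → x = 0)
    {j : ℕ} (hj1 : 1 ≤ j) (hjp : j < p) :
    hermitianOfBilin B (eigencomponent τ p ζ j δ) (eigencomponent τ p ζ j δ) ≠ 0 := by
  intro h0
  have hp0 : 0 < p := hp.pos
  set v : Fin (p - 1) → V := fun k => (τ ^ (k : ℕ)) δ with hv
  have hli : LinearIndependent ℚ v := linearIndependent_pow_apply_of_sum_eq_zero hp hδ hsum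
  have hspan := span_pow_apply_eq hp.two_le hτ hsum
  have hnd' : ∀ x ∈ Submodule.span ℚ (Set.range v), (∀ y ∈ Submodule.span ℚ (Set.range v), B x y = 0) → x = 0 := by
    rw [hv, ← hspan]; exact hnd
  -- `x := conj δ_j` lies in the complex span of the `1 ⊗ τ^k δ`
  set x := conjV V (eigencomponent τ p ζ j δ) with hx
  have hxmem : x ∈ Submodule.span ℂ (Set.range fun k : Fin (p - 1) => (1 : ℂ) ⊗ₜ[ℚ] v k) := by
    rw [hx, conjV_eigencomponent]
    have h := eigencomponent_mem_span τ p (conj ζ) j δ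
    refine (Submodule.span_le.2 ?_) h
    rintro _ ⟨i, rfl⟩
    exact one_tmul_pow_apply_mem_span_fin hp.two_le hτ hsum i
  -- and is `B_ℂ`-orthogonal to every `1 ⊗ τ^k δ`
  have horth : ∀ k : Fin (p - 1), B.baseChange ℂ x ((1 : ℂ) ⊗ₜ v k) = 0 := by
    intro k
    rw [hv]
    dsimp only
    rw [tmul_pow_apply_eq_sum_eigencomponent hτ hζ hp0 (k : ℕ) δ, map_sum]
    refine Finset.sum_eq_zero fun m hm => ?_
    rw [map_smul, smul_eq_mul]
    have hmp : m < p := Finset.mem_range.1 hm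
    have hval : B.baseChange ℂ x (eigencomponent τ p ζ m δ) = hermitianOfBilin B (eigencomponent τ p ζ j δ)
        (eigencomponent τ p ζ m δ) := by rw [hermitianOfBilin_apply]
    rw [hval]
    by_cases hmj : m = j
    · rw [hmj, h0, mul_zero]
    · rw [hermitianOfBilin_eigencomponent_eq_zero_of_ne hτ hζ hp0 hτB δ hjp hmp hmj, mul_zero]
  have hx0 : x = 0 := eq_zero_of_mem_span_tmul_of_forall_baseChange_eq_zero hB v hli hnd' hxmem horth
  have : eigencomponent τ p ζ j δ = 0 := by
    rw [← conjV_conjV (V := V) (eigencomponent τ p ζ j δ), ← hx, hx0, map_zero]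
  exact eigencomponent_ne_zero hp hτ hζ hB hδ hsum hnd hj1 hjp this

end Literature.AlgebraicGeometry.HodgeTheory

end
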